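import Summits.ResolutionOfSingularities.ResolutionOfSingularities.Theorems.PurelyInseparableDim4SwapRelation
import Summits.ResolutionOfSingularities.ResolutionOfSingularities.Theorems.PurelyInseparableDim4PthPowerFactor
import HarnessLib
import HarnessLib.Audit.Tags

/-!
# Purely inseparable four-folds — a unit-class frame propagates through a light step taken at corresponding points of
# two presentations (cell `res-dim4-pi`, K2(p) lane, brick «swap normalisation», FILE SN3)

[OURS · counted 0 · cell `res-dim4-pi` · seat res-dim4-p-11 g3 · the statement is res-dim4-p-7 g3's SN3 in the letter-bijection
form (bus 2026-08-29T01:59:06Z, l.3647), verbatim; desk WORD #122.]  Nothing here proves K2(p), `NoIsolatedTrap p p`, or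
resolution of singularities in dimension ≥ 4 / characteristic `p`.  AI kernel work, weaker than expert review.

Setting.  Two presentations `A`, `B` of one state are related by `B.F = clean(Uᵖ · θ(A.F)) + E` with `E ∈ 𝔪₀ᴹ`, `U(0) ≠ 0`,
and a substitution `θ` of UNIT CLASS along a letter bijection `π`: `θ(x_{π i}) = x_i · e_i` (`i ≠ f`), `θ(x_{π f}) =
x_f · e_f + G` with units `e_i`, `G(0) = 0` and no `x_f`-term in `G`.  Both sides now take the light step at the SAME closed
point: `B` in the chart `ℓ ≠ f` translating `x_f` by `γ'`, `A` in the chart `π ℓ` translating `x_{π f}` by `γ`, the 1-jets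
being related by `γ · e_ℓ(0) = ∂G/∂x_ℓ(0) + γ' · e_f(0)` (`hγ`).  **`unitFrame_step`**: the children are again related by a
unit-class frame along the same `π`, with error in `𝔪₀^{M − p}`.

Proof (§3).  With `β` / `α` the two blow-up substitutions (`FreeTailProof.aeval_blowup_eq`: `F∘β = x_ℓᵖ · T_B`,
`F∘α = x_{πℓ}ᵖ · T_A`): `e⁺_ℓ = e_ℓ∘β`, `e⁺_i = (e_i∘β)·W` (`W` an inverse of `e_ℓ∘β` modulo `𝔪₀ᴹ`, FLAT along `x_ℓ`:
`W ≡ W(0) mod (x_ℓ)`, §2), `θ⁺(x_{πf}) = W·((x_f + γ')(e_f∘β) + G̃) − γ` where `x_ℓ · G̃ = G∘β` (§3: `G̃(0) = ∂G/∂x_ℓ(0)`, no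
`x_f`-term), `U⁺ = (U∘β)·(e_ℓ∘β)`; then `θ⁺∘α ≡ β∘θ` letterwise modulo `𝔪₀ᴹ`, so `x_ℓᵖ · E⁺ = clean(E∘β) − clean((U∘β)ᵖ·D)` with
`D ∈ 𝔪₀ᴹ`, and `E⁺ ∈ 𝔪₀^{M−p}` (§1, p-7 g3's `SwapNorm.deletePthPowers_mem_pow`).  Cleaning commutes with `x_ℓᵖ ·` and kills `p`-th powers through substitutions
(`SwapNorm.deletePthPowers_mul_aeval_deletePthPowers`).
[cite: Hauser2010, §§F–G (chart expressions of a point blowup; cleaning)] [folklore] bears_on: LADDER-RESOLUTION:D157-DOOR2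
(res-dim4-pi · K2(p) · swap normalisation SN3).  Supports stmt-ResolutionOfSingularities-16155 (helper).
-/

set_option linter.dupNamespace false -- mandated namespace of this single-conjunct summit

noncomputable section

namespace Summit.ResolutionOfSingularities.ResolutionOfSingularities.Theorems.PIDim4

namespace SwapTransport

open MvPolynomial Finset
open Literature.AlgebraicGeometry.Resolution
open Literature.AlgebraicGeometry.Resolution.CentreBlowup
open Literature.AlgebraicGeometry.Resolution.Hauser2010

variable {K : Type} [Field K]

/-! ## §1 `𝔪₀`-adic bookkeeping: dividing by `x_ℓⁿ`, cleaning -/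

/-- `x_ℓⁿ · E ∈ 𝔪₀ᴹ ⇒ E ∈ 𝔪₀^{M − n}`. [folklore] -/
theorem mem_pow_sub_of_X_pow_mul_mem {ℓ : Fin 4} {n M : ℕ} {E : MvPolynomial (Fin 4) K}
    (h : X ℓ ^ n * E ∈ originIdeal K ^ M) : E ∈ originIdeal K ^ (M - n) := by
  classical
  rw [IsolationCert.mem_originIdeal_pow_iff] at h ⊢
  intro d hd
  have h1 := h (Finsupp.single ℓ n + d) (by rw [map_add, Finsupp.degree_single]; omega)
  rwa [X_pow_eq_monomial, coeff_monomial_mul, one_mul] at h1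

/-- Cleaning commutes with multiplication by `x_ℓᵖ`. [folklore] -/
theorem deletePthPowers_X_pow_mul (p : ℕ) (ℓ : Fin 4) (H : MvPolynomial (Fin 4) K) :
    deletePthPowers p (X ℓ ^ p * H) = X ℓ ^ p * deletePthPowers p H := by
  rw [X_pow_eq_monomial]
  refine PthPowerFactor.deletePthPowers_monomial_mul p (fun i => ?_) 1 H
  by_cases hi : i = ℓ
  · subst hi
    rw [Finsupp.single_eq_same]
  · rw [Finsupp.single_eq_of_ne hi]
    exact dvd_zero p

/-- Cleaning kills `p`-th powers through any substitution: `clean((clean V)∘β) = clean(V∘β)`. [cite: Hauser2010, §G] -/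
theorem deletePthPowers_aeval_deletePthPowers (p : ℕ) [Fact p.Prime] [CharP K p]
    (β : Fin 4 → MvPolynomial (Fin 4) K) (V : MvPolynomial (Fin 4) K) :
    deletePthPowers p (aeval β (deletePthPowers p V)) = deletePthPowers p (aeval β V) := by
  have h := SwapNorm.deletePthPowers_mul_aeval_deletePthPowers p 1 β V
  rwa [one_pow, one_mul, one_mul] at h

/-! ## §2 Flatness along a letter and flat inverses of units modulo `𝔪₀ᴹ` -/

/-- A polynomial flat along `x_ℓ` (`P ≡ c mod (x_ℓ)`) has no `x_f`-term (`f ≠ ℓ`). [folklore] -/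
theorem coeff_single_eq_zero_of_sub_C_mem {ℓ f : Fin 4} (hℓf : ℓ ≠ f) {P : MvPolynomial (Fin 4) K} {c : K}
    (h : P - C c ∈ Ideal.span {(X ℓ : MvPolynomial (Fin 4) K)}) : coeff (Finsupp.single f 1) P = 0 := by
  classical
  obtain ⟨Q, hQ⟩ := Ideal.mem_span_singleton'.mp h
  have hP : P = C c + X ℓ * Q := by rw [mul_comm, hQ]; ring
  have hns : ℓ ∉ (Finsupp.single f 1).support := by
    rw [Finsupp.mem_support_iff, Finsupp.single_eq_of_ne hℓf]; exact fun h => h rfl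
  rw [hP, coeff_add, coeff_C, if_neg (Ne.symm (Finsupp.single_ne_zero.mpr one_ne_zero)), coeff_X_mul', if_neg hns,
    add_zero]

/-- For `W` flat along `x_ℓ`: the `x_f`-coefficient of `W · T` is `W(0) ·` that of `T` (`f ≠ ℓ`). [folklore] -/
theorem coeff_single_mul_of_sub_C_mem {ℓ f : Fin 4} (hℓf : ℓ ≠ f) {W : MvPolynomial (Fin 4) K} {w : K}
    (h : W - C w ∈ Ideal.span {(X ℓ : MvPolynomial (Fin 4) K)}) (T : MvPolynomial (Fin 4) K) :
    coeff (Finsupp.single f 1) (W * T) = w * coeff (Finsupp.single f 1) T := by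
  classical
  obtain ⟨Q, hQ⟩ := Ideal.mem_span_singleton'.mp h
  have hW : W * T = C w * T + X ℓ * (Q * T) := by
    rw [show W = C w + Q * X ℓ by rw [hQ]; ring]
    ring
  have hns : ℓ ∉ (Finsupp.single f 1).support := by
    rw [Finsupp.mem_support_iff, Finsupp.single_eq_of_ne hℓf]; exact fun h => h rfl
  rw [hW, coeff_add, coeff_C_mul, coeff_X_mul', if_neg hns, add_zero]

/-- **Flat inverse modulo `𝔪₀ᴹ`.**  A polynomial `ε` with `ε(0) ≠ 0` and `ε ≡ ε(0) mod (x_ℓ)` has, for every `M`, an inverse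
`W` modulo `𝔪₀ᴹ` with `W(0) ε(0) = 1` and `W ≡ W(0) mod (x_ℓ)` (the geometric sum in `q = −ε(0)⁻¹(ε − ε(0)) ∈ (x_ℓ)`).
[folklore] -/
theorem exists_flat_inv {ℓ : Fin 4} {ε : MvPolynomial (Fin 4) K} (hε : constantCoeff ε ≠ 0)
    (hflat : ε - C (constantCoeff ε) ∈ Ideal.span {(X ℓ : MvPolynomial (Fin 4) K)}) (M : ℕ) :
    ∃ W : MvPolynomial (Fin 4) K, constantCoeff W * constantCoeff ε = 1 ∧
      W - C (constantCoeff W) ∈ Ideal.span {(X ℓ : MvPolynomial (Fin 4) K)} ∧ W * ε - 1 ∈ originIdeal K ^ M := by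
  obtain ⟨c, hc⟩ : ∃ c : K, c = constantCoeff ε := ⟨_, rfl⟩
  rw [← hc] at hε hflat
  obtain ⟨q, hq⟩ : ∃ q : MvPolynomial (Fin 4) K, q = -(C c⁻¹ * (ε - C c)) := ⟨_, rfl⟩
  have hq0 : constantCoeff q = 0 := by
    rw [hq, map_neg, map_mul, map_sub, constantCoeff_C, constantCoeff_C, ← hc, sub_self, mul_zero, neg_zero]
  have hqℓ : q ∈ Ideal.span {(X ℓ : MvPolynomial (Fin 4) K)} := by
    rw [hq]
    exact Submodule.neg_mem _ (Ideal.mul_mem_left _ _ hflat)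
  have hεq : ε = C c * (1 - q) := by
    rw [hq, mul_sub, mul_one, mul_neg, ← mul_assoc, ← C_mul, mul_inv_cancel₀ hε, C_1, one_mul]
    ring
  have hW0 : constantCoeff (C c⁻¹ * ∑ k ∈ Finset.range (M + 1), q ^ k) = c⁻¹ := by
    rw [map_mul, constantCoeff_C, map_sum, Finset.sum_range_succ', pow_zero, map_one,
      Finset.sum_eq_zero (fun k _ => by rw [pow_succ, map_mul, hq0, mul_zero]), zero_add, mul_one]
  refine ⟨C c⁻¹ * ∑ k ∈ Finset.range (M + 1), q ^ k, ?_, ?_, ?_⟩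
  · rw [hW0, ← hc, inv_mul_cancel₀ hε]
  · rw [hW0, Finset.sum_range_succ', pow_zero, mul_add, mul_one, add_sub_cancel_right, Finset.mul_sum]
    refine Ideal.sum_mem _ fun k _ => ?_
    rw [pow_succ, ← mul_assoc]
    exact Ideal.mul_mem_left _ _ hqℓ
  · rw [hεq, show C c⁻¹ * (∑ k ∈ Finset.range (M + 1), q ^ k) * (C c * (1 - q)) =
        (C c⁻¹ * C c) * ((1 - q) * ∑ k ∈ Finset.range (M + 1), q ^ k) by ring, mul_neg_geom_sum, ← C_mul,
      inv_mul_cancel₀ hε, C_1, one_mul, sub_sub_cancel_left]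
    refine Submodule.neg_mem _ (Ideal.pow_le_pow_right (Nat.le_succ M) (Ideal.pow_mem_pow ?_ _))
    exact (NarrowApolarity.mem_originIdeal_iff q).mpr hq0

/-! ## §3 The blow-up substitution: origin-fixing, values in `(x_ℓ)` -/

/-- The blow-up substitution `β_{ℓ,b}` (`x_ℓ ↦ x_ℓ`, `x_i ↦ x_ℓ (x_i + b_i)`) fixes the origin. [folklore] -/
theorem constantCoeff_blowup (ℓ : Fin 4) (b : Fin 4 → K) (i : Fin 4) :
    constantCoeff ((fun i => if i = ℓ then (X ℓ : MvPolynomial (Fin 4) K) else X ℓ * (X i + C (b i))) i) = 0 := by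
  simp only
  split_ifs <;> simp

/-- The blow-up substitution maps `𝔪₀ⁿ` into `(x_ℓⁿ)`. [folklore] -/
theorem aeval_blowup_mem_span_pow (ℓ : Fin 4) (b : Fin 4 → K) {n : ℕ} {G : MvPolynomial (Fin 4) K}
    (hG : G ∈ originIdeal K ^ n) :
    aeval (fun i => if i = ℓ then (X ℓ : MvPolynomial (Fin 4) K) else X ℓ * (X i + C (b i))) G ∈
      Ideal.span {(X ℓ : MvPolynomial (Fin 4) K) ^ n} := by
  rw [← Ideal.span_singleton_pow]
  have h : (originIdeal K ^ n).map
      (aeval (fun i => if i = ℓ then (X ℓ : MvPolynomial (Fin 4) K) else X ℓ * (X i + C (b i)))).toRingHom ≤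
      (Ideal.span {(X ℓ : MvPolynomial (Fin 4) K)}) ^ n := by
    rw [Ideal.map_pow, ApproxCoordChange.originIdeal_eq_span_range_X, Ideal.map_span]
    refine Ideal.pow_right_mono ?_ n
    rw [Ideal.span_le]
    rintro _ ⟨_, ⟨i, rfl⟩, rfl⟩
    rw [SetLike.mem_coe, AlgHom.toRingHom_eq_coe, RingHom.coe_coe, aeval_X]
    split_ifs
    · exact Ideal.mem_span_singleton_self _
    · exact Ideal.mul_mem_right _ _ (Ideal.mem_span_singleton_self _)
  exact h (Ideal.mem_map_of_mem _ hG)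

/-- Every image under the blow-up substitution is flat along `x_ℓ`: `H∘β ≡ H(0) mod (x_ℓ)`. [folklore] -/
theorem aeval_blowup_sub_C_mem (ℓ : Fin 4) (b : Fin 4 → K) (H : MvPolynomial (Fin 4) K) :
    aeval (fun i => if i = ℓ then (X ℓ : MvPolynomial (Fin 4) K) else X ℓ * (X i + C (b i))) H - C (constantCoeff H) ∈
      Ideal.span {(X ℓ : MvPolynomial (Fin 4) K)} := by
  have h1 : H - C (constantCoeff H) ∈ originIdeal K ^ 1 := by
    rw [pow_one]
    exact (NarrowApolarity.mem_originIdeal_iff _).mpr (by rw [map_sub, constantCoeff_C, sub_self])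
  have h2 := aeval_blowup_mem_span_pow ℓ b h1
  rwa [pow_one, map_sub, aeval_C, algebraMap_eq] at h2

/-! ## §4 THE TRANSPORT of a unit-class frame through a light step -/

/-- **Unit-class frame through a light step** (res-dim4-p-7 g3's SN3, letter-bijection form, verbatim).  See the module
docstring: from `B.F = clean(Uᵖ · θ(A.F)) + E`, `E ∈ 𝔪₀ᴹ`, `θ` of unit class along `π` with free letters `f ↔ π f`, and the
1-jet relation `hγ`, the children `step ℓ (γ' e_f) B` and `step (π ℓ) (γ e_{π f}) A` (`ℓ ≠ f`) satisfy the same relation with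
new data `θ⁺, e⁺, G⁺, U⁺` of the same shape and an error `E⁺ ∈ 𝔪₀^{M − p}`.
[cite: Hauser2010, §§F–G (chart expressions of a point blowup; cleaning)] [folklore] -/
theorem unitFrame_step (p : ℕ) [Fact p.Prime] [CharP K p] [DecidableEq K] (π : Equiv.Perm (Fin 4)) (f : Fin 4)
    {M : ℕ} {A B : State K} {θ e : Fin 4 → MvPolynomial (Fin 4) K} {G U E : MvPolynomial (Fin 4) K}
    (hθi : ∀ i, i ≠ f → θ (π i) = X i * e i) (hθf : θ (π f) = X f * e f + G)
    (he : ∀ i, constantCoeff (e i) ≠ 0) (hG0 : constantCoeff G = 0) (hG1 : coeff (Finsupp.single f 1) G = 0)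
    (hU : constantCoeff U ≠ 0) (hE : E ∈ originIdeal K ^ M)
    (hrel : B.F = deletePthPowers p (U ^ p * aeval θ A.F) + E)
    (hA : (p : ℕ∞) ≤ ordAlong Finset.univ A.F) (hB : (p : ℕ∞) ≤ ordAlong Finset.univ B.F)
    {ℓ : Fin 4} (hℓf : ℓ ≠ f) {γ γ' : K}
    (hγ : γ * constantCoeff (e ℓ) = coeff (Finsupp.single ℓ 1) G + γ' * constantCoeff (e f)) :
    ∃ (θ' e' : Fin 4 → MvPolynomial (Fin 4) K) (G' U' E' : MvPolynomial (Fin 4) K),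
      (∀ i, i ≠ f → θ' (π i) = X i * e' i) ∧ θ' (π f) = X f * e' f + G' ∧ (∀ i, constantCoeff (e' i) ≠ 0) ∧
      constantCoeff G' = 0 ∧ coeff (Finsupp.single f 1) G' = 0 ∧ constantCoeff U' ≠ 0 ∧
      E' ∈ originIdeal K ^ (M - p) ∧
      (step p Finset.univ ℓ (Pi.single f γ' : Fin 4 → K) B).F =
        deletePthPowers p (U' ^ p *
          aeval θ' (step p Finset.univ (π ℓ) (Pi.single (π f) γ : Fin 4 → K) A).F) + E' := by
  classical
  -- the two points and the two blow-up substitutions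
  obtain ⟨b', hb'⟩ : ∃ b' : Fin 4 → K, b' = Pi.single f γ' := ⟨_, rfl⟩
  obtain ⟨b, hb⟩ : ∃ b : Fin 4 → K, b = Pi.single (π f) γ := ⟨_, rfl⟩
  have hπℓf : π ℓ ≠ π f := fun h => hℓf (π.injective h)
  have hb'ℓ : b' ℓ = 0 := by rw [hb']; exact Pi.single_eq_of_ne hℓf _
  have hb'f : b' f = γ' := by rw [hb']; exact Pi.single_eq_same _ _
  have hb'i : ∀ i, i ≠ f → b' i = 0 := fun i hi => by rw [hb']; exact Pi.single_eq_of_ne hi _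
  have hbℓ : b (π ℓ) = 0 := by rw [hb]; exact Pi.single_eq_of_ne hπℓf _
  have hbf : b (π f) = γ := by rw [hb]; exact Pi.single_eq_same _ _
  have hbi : ∀ i, i ≠ f → b (π i) = 0 := fun i hi => by
    rw [hb]; exact Pi.single_eq_of_ne (fun h => hi (π.injective h)) _
  obtain ⟨β, hβ⟩ : ∃ β : Fin 4 → MvPolynomial (Fin 4) K,
      β = fun i => if i = ℓ then (X ℓ : MvPolynomial (Fin 4) K) else X ℓ * (X i + C (b' i)) := ⟨_, rfl⟩
  obtain ⟨α, hα⟩ : ∃ α : Fin 4 → MvPolynomial (Fin 4) K,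
      α = fun i => if i = π ℓ then (X (π ℓ) : MvPolynomial (Fin 4) K) else X (π ℓ) * (X i + C (b i)) := ⟨_, rfl⟩
  have hβℓ : β ℓ = X ℓ := by rw [hβ]; simp
  have hβf : β f = X ℓ * (X f + C γ') := by rw [hβ]; simp [hℓf.symm, hb'f]
  have hβi : ∀ i, i ≠ ℓ → i ≠ f → β i = X ℓ * X i := fun i hiℓ hif => by
    rw [hβ]; simp [hiℓ, hb'i i hif]
  have hαℓ : α (π ℓ) = X (π ℓ) := by rw [hα]; simp
  have hαf : α (π f) = X (π ℓ) * (X (π f) + C γ) := by rw [hα]; simp [hπℓf.symm, hbf]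
  have hαi : ∀ i, i ≠ ℓ → i ≠ f → α (π i) = X (π ℓ) * X (π i) := fun i hiℓ hif => by
    rw [hα]; simp [hiℓ, hbi i hif]
  have hβ0 : ∀ i, constantCoeff (β i) = 0 := fun i => by rw [hβ]; exact constantCoeff_blowup ℓ b' i
  -- the chart identities `F∘β = x_ℓᵖ · T_B`, `F∘α = x_{πℓ}ᵖ · T_A`
  have hBch : aeval β B.F = X ℓ ^ p * PointBlowup.translate b' (chartTransform p Finset.univ ℓ B.F) := by
    rw [hβ]; exact FreeTailProof.aeval_blowup_eq p ℓ b' hb'ℓ B.F hB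
  have hAch : aeval α A.F = X (π ℓ) ^ p * PointBlowup.translate b (chartTransform p Finset.univ (π ℓ) A.F) := by
    rw [hα]; exact FreeTailProof.aeval_blowup_eq p (π ℓ) b hbℓ A.F hA
  -- the units `e_i ∘ β`, flat along `x_ℓ`, and the flat inverse `W` of `e_ℓ ∘ β`
  have hεc : ∀ H : MvPolynomial (Fin 4) K, constantCoeff (aeval β H) = constantCoeff H :=
    fun H => CoordChange.constantCoeff_aeval_of_origin β hβ0 H
  have hεflat : ∀ H : MvPolynomial (Fin 4) K,
      aeval β H - C (constantCoeff (aeval β H)) ∈ Ideal.span {(X ℓ : MvPolynomial (Fin 4) K)} := fun H => by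
    rw [hεc, hβ]; exact aeval_blowup_sub_C_mem ℓ b' H
  obtain ⟨W, hWc, hWflat, hWinv⟩ := exists_flat_inv (by rw [hεc]; exact he ℓ) (hεflat (e ℓ)) M
  rw [hεc] at hWc
  -- `G ∘ β = x_ℓ · G̃` with `G̃(0) = ∂G/∂x_ℓ(0)` and no `x_f`-term
  obtain ⟨L, hL⟩ : ∃ L : MvPolynomial (Fin 4) K, L = C (coeff (Finsupp.single ℓ 1) G) +
      ∑ i ∈ Finset.univ.erase ℓ, C (coeff (Finsupp.single i 1) G) * (X i + C (b' i)) := ⟨_, rfl⟩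
  have hG₁β : aeval β (∑ i, C (coeff (Finsupp.single i 1) G) * X i) = X ℓ * L := by
    rw [map_sum, ← Finset.add_sum_erase Finset.univ _ (Finset.mem_univ ℓ), hL, mul_add, Finset.mul_sum]
    simp only [map_mul, aeval_C, algebraMap_eq, aeval_X, hβℓ]
    rw [mul_comm]
    refine congrArg _ (Finset.sum_congr rfl fun i hi => ?_)
    rw [hβ]
    simp only [if_neg (Finset.ne_of_mem_erase hi)]
    ring
  obtain ⟨H₂, hH₂⟩ := Ideal.mem_span_singleton'.mp (hβ ▸ aeval_blowup_mem_span_pow ℓ b' (SwapNorm.sub_linearForm_mem_sq hG0))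
  obtain ⟨Gt, hGt⟩ : ∃ Gt : MvPolynomial (Fin 4) K, Gt = L + X ℓ * H₂ := ⟨_, rfl⟩
  have hGβ : aeval β G = X ℓ * Gt := by
    have h1 : aeval β G = aeval β (∑ i, C (coeff (Finsupp.single i 1) G) * X i) +
        aeval β (G - ∑ i, C (coeff (Finsupp.single i 1) G) * X i) := by rw [← map_add]; ring_nf
    rw [h1, hG₁β, ← hH₂, hGt]
    ring
  have hGt0 : constantCoeff Gt = coeff (Finsupp.single ℓ 1) G := by
    rw [hGt, map_add, map_mul, constantCoeff_X, zero_mul, add_zero, hL, map_add, constantCoeff_C, map_sum,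
      Finset.sum_eq_zero, add_zero]
    intro i hi
    rw [map_mul, constantCoeff_C, map_add, constantCoeff_X, constantCoeff_C, zero_add]
    by_cases hif : i = f
    · rw [hif, hG1, zero_mul]
    · rw [hb'i i hif, mul_zero]
  have hGt1 : coeff (Finsupp.single f 1) Gt = 0 := by
    have hns : ℓ ∉ (Finsupp.single f 1).support := by
      rw [Finsupp.mem_support_iff, Finsupp.single_eq_of_ne hℓf]; exact fun h => h rfl
    rw [hGt, coeff_add, coeff_X_mul', if_neg hns, add_zero, hL, coeff_add, coeff_C,
      if_neg (Ne.symm (Finsupp.single_ne_zero.mpr one_ne_zero)), zero_add, coeff_sum, Finset.sum_eq_zero]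
    intro i hi
    rw [coeff_C_mul, coeff_add, coeff_C, if_neg (Ne.symm (Finsupp.single_ne_zero.mpr one_ne_zero)), add_zero]
    by_cases hif : i = f
    · rw [hif, hG1, zero_mul]
    · rw [coeff_X, if_neg (fun h => hif ((Finsupp.single_left_inj one_ne_zero).mp h)), mul_zero]
  -- the new data
  obtain ⟨e', he'⟩ : ∃ e' : Fin 4 → MvPolynomial (Fin 4) K,
      e' = fun i => aeval β (e i) * (if i = ℓ then 1 else W) := ⟨_, rfl⟩
  obtain ⟨G', hG'⟩ : ∃ G' : MvPolynomial (Fin 4) K, G' = W * (C γ' * aeval β (e f) + Gt) - C γ := ⟨_, rfl⟩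
  obtain ⟨θ', hθ'⟩ : ∃ θ' : Fin 4 → MvPolynomial (Fin 4) K,
      θ' = fun k => if π.symm k = f then X f * e' f + G' else X (π.symm k) * e' (π.symm k) := ⟨_, rfl⟩
  obtain ⟨U', hU'⟩ : ∃ U' : MvPolynomial (Fin 4) K, U' = aeval β U * aeval β (e ℓ) := ⟨_, rfl⟩
  have hθ'i : ∀ i, i ≠ f → θ' (π i) = X i * e' i := fun i hi => by
    rw [hθ']; simp only [Equiv.symm_apply_apply, if_neg hi]
  have hθ'f : θ' (π f) = X f * e' f + G' := by rw [hθ']; simp only [Equiv.symm_apply_apply, if_true]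
  have he'ℓ : e' ℓ = aeval β (e ℓ) := by rw [he']; simp
  have he'i : ∀ i, i ≠ ℓ → e' i = aeval β (e i) * W := fun i hi => by rw [he']; simp [hi]
  have hWcne : constantCoeff W ≠ 0 := left_ne_zero_of_mul_eq_one hWc
  -- the letterwise congruence `θ⁺∘α ≡ β∘θ mod 𝔪₀ᴹ`
  have hΘ : ∀ k, aeval θ' (α k) - aeval β (θ k) ∈ originIdeal K ^ M := by
    intro k
    obtain ⟨i, rfl⟩ := π.surjective k
    by_cases hiℓ : i = ℓ
    · subst hiℓ
      rw [hαℓ, aeval_X, hθ'i _ hℓf, he'ℓ, hθi _ hℓf, map_mul, aeval_X, hβℓ, sub_self]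
      exact Submodule.zero_mem _
    · by_cases hif : i = f
      · subst hif
        rw [hαf, map_mul, map_add, aeval_X, aeval_X, aeval_C, algebraMap_eq, hθ'i ℓ hℓf, he'ℓ, hθ'f, he'i _ hℓf.symm,
          hθf, map_add, map_mul, aeval_X, hβf, hGβ, hG']
        rw [show X ℓ * aeval β (e ℓ) * (X i * (aeval β (e i) * W) + (W * (C γ' * aeval β (e i) + Gt) - C γ) + C γ) -
            (X ℓ * (X i + C γ') * aeval β (e i) + X ℓ * Gt) =
            X ℓ * ((X i + C γ') * aeval β (e i) + Gt) * (W * aeval β (e ℓ) - 1) by ring]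
        exact Ideal.mul_mem_left _ _ hWinv
      · rw [hαi i hiℓ hif, map_mul, aeval_X, aeval_X, hθ'i ℓ hℓf, he'ℓ, hθ'i i hif, he'i i hiℓ, hθi i hif, map_mul,
          aeval_X, hβi i hiℓ hif]
        rw [show X ℓ * aeval β (e ℓ) * (X i * (aeval β (e i) * W)) - X ℓ * X i * aeval β (e i) =
            X ℓ * X i * aeval β (e i) * (W * aeval β (e ℓ) - 1) by ring]
        exact Ideal.mul_mem_left _ _ hWinv
  have hD : aeval (fun k => aeval θ' (α k)) A.F - aeval (fun k => aeval β (θ k)) A.F ∈ originIdeal K ^ M :=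
    ApproxCoordChange.aeval_sub_aeval_mem hΘ A.F
  -- abbreviations for the two point transforms and the error
  obtain ⟨TA, hTA⟩ : ∃ TA : MvPolynomial (Fin 4) K,
      TA = PointBlowup.translate b (chartTransform p Finset.univ (π ℓ) A.F) := ⟨_, rfl⟩
  obtain ⟨TB, hTB⟩ : ∃ TB : MvPolynomial (Fin 4) K,
      TB = PointBlowup.translate b' (chartTransform p Finset.univ ℓ B.F) := ⟨_, rfl⟩
  have hstepB : (step p Finset.univ ℓ (Pi.single f γ' : Fin 4 → K) B).F = deletePthPowers p TB := by
    rw [hTB, hb']; rfl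
  have hstepA : (step p Finset.univ (π ℓ) (Pi.single (π f) γ : Fin 4 → K) A).F = deletePthPowers p TA := by
    rw [hTA, hb]; rfl
  rw [← hTB] at hBch
  rw [← hTA] at hAch
  obtain ⟨D, hDdef⟩ : ∃ D : MvPolynomial (Fin 4) K,
      D = aeval (fun k => aeval θ' (α k)) A.F - aeval (fun k => aeval β (θ k)) A.F := ⟨_, rfl⟩
  rw [← hDdef] at hD
  -- the key identity `x_ℓᵖ · clean T_B = x_ℓᵖ · clean(U⁺ᵖ · θ⁺(clean T_A)) + (clean(E∘β) − clean((U∘β)ᵖ · D))`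
  have hθ'ℓp : aeval θ' (X (π ℓ) ^ p * TA) = (X ℓ * aeval β (e ℓ)) ^ p * aeval θ' TA := by
    rw [map_mul, map_pow, aeval_X, hθ'i ℓ hℓf, he'ℓ]
  have hkey : X ℓ ^ p * deletePthPowers p TB =
      X ℓ ^ p * deletePthPowers p (U' ^ p * aeval θ' (deletePthPowers p TA)) +
        (deletePthPowers p (aeval β E) - deletePthPowers p (aeval β U ^ p * D)) := by
    have h1 : X ℓ ^ p * deletePthPowers p TB = deletePthPowers p (aeval β B.F) := by
      rw [← deletePthPowers_X_pow_mul, hBch]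
    have h2 : aeval β (U ^ p * aeval θ A.F) = X ℓ ^ p * (U' ^ p * aeval θ' TA) - aeval β U ^ p * D := by
      rw [map_mul, map_pow, ApproxCoordChange.aeval_aeval, hDdef, ← ApproxCoordChange.aeval_aeval θ' α, hAch, hθ'ℓp, hU']
      ring
    rw [h1, hrel, map_add, deletePthPowers_add, deletePthPowers_aeval_deletePthPowers, h2, SwapNorm.deletePthPowers_sub',
      deletePthPowers_X_pow_mul, SwapNorm.deletePthPowers_mul_aeval_deletePthPowers]
    ring
  obtain ⟨E', hE'⟩ : ∃ E' : MvPolynomial (Fin 4) K,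
      E' = deletePthPowers p TB - deletePthPowers p (U' ^ p * aeval θ' (deletePthPowers p TA)) := ⟨_, rfl⟩
  have hE'M : X ℓ ^ p * E' ∈ originIdeal K ^ M := by
    rw [hE', mul_sub, hkey, add_sub_cancel_left]
    refine Ideal.sub_mem _ (SwapNorm.deletePthPowers_mem_pow p (SwapNorm.aeval_mem_pow hβ0 hE)) ?_
    exact SwapNorm.deletePthPowers_mem_pow p (Ideal.mul_mem_left _ _ hD)
  refine ⟨θ', e', G', U', E', hθ'i, hθ'f, fun i => ?_, ?_, ?_, ?_, mem_pow_sub_of_X_pow_mul_mem hE'M, ?_⟩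
  · -- units
    by_cases hiℓ : i = ℓ
    · rw [hiℓ, he'ℓ, hεc]; exact he ℓ
    · rw [he'i i hiℓ, map_mul, hεc]; exact mul_ne_zero (he i) hWcne
  · -- `G⁺(0) = 0`: this is the 1-jet relation `hγ`
    rw [hG', map_sub, map_mul, map_add, map_mul, constantCoeff_C, constantCoeff_C, hεc, hGt0,
      show γ' * constantCoeff (e f) + coeff (Finsupp.single ℓ 1) G = γ * constantCoeff (e ℓ) by rw [hγ]; ring]
    linear_combination γ * hWc
  · -- no `x_f`-term in `G⁺`
    rw [hG', coeff_sub, coeff_single_mul_of_sub_C_mem hℓf hWflat, coeff_add, coeff_C_mul,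
      coeff_single_eq_zero_of_sub_C_mem hℓf (hεflat (e f)), hGt1, coeff_C,
      if_neg (Ne.symm (Finsupp.single_ne_zero.mpr one_ne_zero))]
    ring
  · rw [hU', map_mul, hεc, hεc]; exact mul_ne_zero hU (he ℓ)
  · rw [hstepB, hstepA, hE']
    ring

end SwapTransport

end Summit.ResolutionOfSingularities.ResolutionOfSingularities.Theorems.PIDim4

end
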